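import Summits.Parity.GeneralizedHardyLittlewood.Theses.ZDegreeToeplitzBand

/-! # Line `explicit-twins` for crux `LongPairsGradedTables` (stmt-Parity-20446 = 𝒳₂, HELD)

Registration of the route's two CLOSED-FORM-RESTRICTED TWIN items as the line through which a closed-form
instance `E : KnifeEdge.PsiGradedClosedForms` would close the full-class remainder 𝒳₂:
`PsiDegOneSlotsExplicit` (stmt-Parity-20031, degree-1 cross/dual tables on the WHOLE class) and
`TauTwoSlotExplicit` (stmt-Parity-20032, degree-2 table on the whole class) ⇒ `LongPairsGradedTables`
(restriction to the long class `¬ ShortPairs` by `CrossTablePsi.on` / `DualCrossTablePsi.on`).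
Both stubs are the route's OWN typed items BY NAME (tenure planner ls-knife-plan g1, 2026-08-27, brief (b)
«e0-horn registration»); all three items are HELD (X2-HOLD-v2.1.md 284fed37e3c9b383: long pairs are
WRAP-OR-DARK; not prover targets until F1/F2/DISPLAY #6). Nothing here is a theorem about 𝒳₂. -/

namespace Summit.Parity.GeneralizedHardyLittlewood.Cruxes.LongPairsGradedTables.ExplicitTwins

open Literature.NumberTheory.LFunctions.Zhang2022
open Summit.Parity.GeneralizedHardyLittlewood.Theses.ZDegreeToeplitzBand

/-- stub 1 = the route item stmt-Parity-20031 `PsiDegOneSlotsExplicit` (support, HELD): closed-form degree-1 tables. -/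
theorem stub_psiDegOneSlotsExplicit : PsiDegOneSlotsExplicit := by
  sorry

/-- stub 2 = the route item stmt-Parity-20032 `TauTwoSlotExplicit` (crux r2, XL, HELD): closed-form degree-2 table. -/
theorem stub_tauTwoSlotExplicit : TauTwoSlotExplicit := by
  sorry

/-- Composition: the two closed-form twins give 𝒳₂ = `LongPairsGradedTables` (restriction of whole-class tables to
the long class; the two eventual thresholds are joined by `max`). -/
theorem LongPairsGradedTables_of : PsiDegOneSlotsExplicit → TauTwoSlotExplicit → LongPairsGradedTables := by
  rintro ⟨c₁, h1⟩ ⟨c₂, h2⟩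
  refine ⟨max c₁ c₂, fun c' hc' => ?_⟩
  obtain ⟨E, hX, hY⟩ := h1 c' ((le_max_left _ _).trans hc')
  obtain ⟨E', hT⟩ := h2 c' ((le_max_right _ _).trans hc')
  exact ⟨E.X₁psi, E.Y₁psi, E'.X₂psiDiag, hX.on _, hY.on _, hT⟩

/-- The same composition also yields the parent K1 `PsiGradedTables` directly (whole class). -/
theorem psiGradedTables_of : PsiDegOneSlotsExplicit → TauTwoSlotExplicit → PsiGradedTables := by
  rintro ⟨c₁, h1⟩ ⟨c₂, h2⟩
  refine ⟨max c₁ c₂, fun c' hc' => ?_⟩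
  obtain ⟨E, hX, hY⟩ := h1 c' ((le_max_left _ _).trans hc')
  obtain ⟨E', hT⟩ := h2 c' ((le_max_right _ _).trans hc')
  exact ⟨E.X₁psi, E.Y₁psi, E'.X₂psiDiag, hX, hY, hT⟩

end Summit.Parity.GeneralizedHardyLittlewood.Cruxes.LongPairsGradedTables.ExplicitTwins
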